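import Summits.QuantumFields.BalabanUV.Beta.SymSecondOrderDeltaSep
import Summits.QuantumFields.BalabanUV.Beta.ChartConjugationDefectImmaterial

/-!
# `BalabanUV.Beta.SymContactTableTransfer` — binder row D1, hR side: **THE `hcomp` IDENTITY OF ROOT N ∕ M′ AT LEVEL `j` DOES NOT READ THE
# CONTACT TABLE AT LEVELS `≥ j`** — for two tables `X2s`, `X2s′` that agree below `j` (equivalently: with the same level-`j` remainder
# `symR2An1 … j`; automatic at `j = 0`), the left side of `hcomp` at `(j, α, μ, y, ν, y′)` is THE SAME REAL NUMBER; in particular a level-0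
# verdict at the pin `X2s := 0` (ROOT M′, where the engine line R-D1-N8-QODD is aimed) is a level-0 verdict for ROOT N at EVERY table (β sub-cell, BINDER-OWNERS row D1; D1 formalisation swarm leaf-03 gen 18 — the LITERAL
# half of the referee's «cheap check» I-d1ref65-1; generic half `ChartConjugationDefectImmaterial`)

HONEST FRAMING (cell contract, verbatim): «discharging `BetaPertH` makes Bałaban's UV stability UNCONDITIONAL — a real constructive-QFT
result; it is NOT the continuum limit and NOT the Clay problem.»  HONEST DEPENDENCY: continuum YM on T⁴ ⇐ BetaPertH ∧ nine spine
estimates (0/9 proved); BetaPertH ⇐ (D1) ∧ (D4) ∧ CAP+tail; G-an2-4 gates asym, D1 and NE2/3/4.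
DERIVED cell leaf ([folklore] bookkeeping + trace cyclicity over OUR objects; no statement of Bałaban's papers, no `[cite:]`, no `def`, no `Prop`
fact).  The `hcomp` LEFT SIDE below is ROOT N's binder text (`RowD1JointEndSymReflTablesAn1S2N` l.102–111) VERBATIM.  MECHANISM: (N11)
`symΔAn1 … X2s j = symΔOfAt … X2s j (symR2An1 … X2s j)` carries the level-`j` table ONLY in the `X₂`-slot of its last `conjW` (same-level) and
through `symR2An1 … j` (levels `< j`; level 0: none) — `symΔOfAt_table_shift`; the W-slot algebra `ChartConjugationDefectImmaterial.wslot_*` and the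
shift form `n8Functional_shift` (trace cyclicity) do the rest.  NOT a proof of `hcomp`, NOT an evaluation (R-D1-g33-2 honoured).  NOT D1, NOT
`BetaPertH`, NOT continuum, NOT Clay.
Provenance: β sub-cell, unit beta-d1-formalise-leaf-03 gen 18, 2026-08-21 (v1); no existing file touched.
-/

noncomputable section

open Finset
open scoped BigOperators
open Literature.Probability.LatticeModels (Torus.proj)
open Literature.MathematicalPhysics.QuantumFieldTheory
open Literature.MathematicalPhysics.QuantumFieldTheory.Balaban1983to89
open Literature.MathematicalPhysics.QuantumFieldTheory.Balaban1983to89.Beta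
open B12Sec2to5 (l1 l1_nonneg)
open ExpKernelCalculus (MKer BiLoc comp tr tadpole)
open AffineAveraging (box toSite)
open AveragingContoursRooted (ctr ctrOff ctrOff_mem_box)
open OneStepResolventKernel (Fib)
open OneStepKernelFamily (KInvStep colH vertexOfK)
open BalabanStepJetsSucc (wVH)
open WilsonVertex2Sym (wsym22)
open Summit.QuantumFields.BalabanUV.Beta.TameKernelCalculus
open Summit.QuantumFields.BalabanUV.Beta.ChartConjugation (conjV conjW conjW₁ conjW₂ loc_conjV)
open Summit.QuantumFields.BalabanUV.Beta.ChartConjugationDefectEnd (conjDefect sandwichDefect)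
open Summit.QuantumFields.BalabanUV.Beta.AxialDressingRooted (one_le_of_neZero)
open Summit.QuantumFields.BalabanUV.Beta.SymmetrisedDressingKernel (coDressKSymAt)
open Summit.QuantumFields.BalabanUV.Beta.SymmetrisedStepJets (Gsym JsB12Sym0)
open Summit.QuantumFields.BalabanUV.Beta.RelInvFactorSandwich (spr_Gsym)
open Summit.QuantumFields.BalabanUV.Beta.SymShiftedSpread (bhKStepSh spr_bhKStepSh)
open Summit.QuantumFields.BalabanUV.Beta.BorderedHessian (bhK stepScale diagK conjV_diagK_apply)
open Summit.QuantumFields.BalabanUV.Beta.E3ContactGenerator (ctGenM)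
open Summit.QuantumFields.BalabanUV.Beta.DshAn1 (Dsh spr_Dsh)
open Summit.QuantumFields.BalabanUV.Beta.SymSecondOrderTablesAn1 (symTablesAn1S2)
open Summit.QuantumFields.BalabanUV.Beta.SymSecondOrderRemainderAn1 (symR2An1 symΔAn1 symΔOfAt)
open Summit.QuantumFields.BalabanUV.Beta.SymSecondOrderDeltaSep (loc_symΔAn1 sep_zeroTable)
open Summit.QuantumFields.BalabanUV.Beta.ChartConjugationDefectImmaterial (n8Functional_shift wslot_eq diagK_add_symbol)

namespace Summit.QuantumFields.BalabanUV.Beta.SymContactTableTransfer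

variable {Lc : ℕ} [NeZero Lc]

/-! ## §1 The same-level table enters `symΔOfAt` through the last `conjW`'s `X₂`-slot only -/

/-- [folklore] **TABLE SHIFT OF THE SPLIT DEFECT at a fixed remainder `R`**: for two tables `X2s`, `X2s′`,
`symΔOfAt … X2s j R α μ y ν y′ = symΔOfAt … X2s′ j R α μ y ν y′ + conjV 𝕄_j (diagK (X2s′ j α μ y ν y′)) − conjV 𝕄_j (diagK (X2s j α μ y ν y′))`
(unfold; the `X₂`-summand of `conjW₂` is `+conjV 𝕄 X₂`; `abel`). -/
theorem symΔOfAt_table_shift (N : ℕ) (cΛ : ℝ) (γ : ℕ → ℝ) (X2s X2s' : ℕ → Fin 4 → Fin 4 → (Fin 4 → ℤ) → Fin 4 → (Fin 4 → ℤ) → (Fin 4 → ℤ) → Fib 3 → ℝ) (j : ℕ)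
    (R : Fin 4 → Fin 4 → (Fin 4 → ℤ) → Fin 4 → (Fin 4 → ℤ) → MKer 4 (Fib 3)) (α μ : Fin 4) (y : Fin 4 → ℤ) (ν : Fin 4) (y' : Fin 4 → ℤ) :
    symΔOfAt Lc N cΛ γ X2s j R α μ y ν y'
      = symΔOfAt Lc N cΛ γ X2s' j R α μ y ν y' + conjV (bhKStepSh 3 Lc (Dsh Lc) j) (diagK (X2s' j α μ y ν y'))
        - conjV (bhKStepSh 3 Lc (Dsh Lc) j) (diagK (X2s j α μ y ν y')) := by
  exact ChartConjugationDefectImmaterial.sub_add_conjW_table_shift _ _ _ _ _ _ _ (diagK (X2s j α μ y ν y')) (diagK (X2s' j α μ y ν y'))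

/-- [folklore] Hence, when the level-`j` remainders agree, the split defects of the two tables differ by the two contact terms only. -/
theorem symΔAn1_table_shift (N : ℕ) (cΛ : ℝ) (γ : ℕ → ℝ) (X2s X2s' : ℕ → Fin 4 → Fin 4 → (Fin 4 → ℤ) → Fin 4 → (Fin 4 → ℤ) → (Fin 4 → ℤ) → Fib 3 → ℝ) (j : ℕ)
    (hR : symR2An1 Lc N cΛ γ X2s j = symR2An1 Lc N cΛ γ X2s' j) (α μ : Fin 4) (y : Fin 4 → ℤ) (ν : Fin 4) (y' : Fin 4 → ℤ) :
    symΔAn1 Lc N cΛ γ X2s j α μ y ν y'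
      = (symΔAn1 Lc N cΛ γ X2s' j α μ y ν y' + conjV (bhKStepSh 3 Lc (Dsh Lc) j) (diagK (X2s' j α μ y ν y')))
        - conjV (bhKStepSh 3 Lc (Dsh Lc) j) (diagK (X2s j α μ y ν y')) := by
  show symΔOfAt Lc N cΛ γ X2s j (symR2An1 Lc N cΛ γ X2s j) α μ y ν y' = _
  rw [hR, symΔOfAt_table_shift N cΛ γ X2s X2s' j]
  rfl

/-- [folklore] The level-0 remainder does not read the table at all. -/
theorem symR2An1_zero_eq (N : ℕ) (cΛ : ℝ) (γ : ℕ → ℝ) (X2s X2s' : ℕ → Fin 4 → Fin 4 → (Fin 4 → ℤ) → Fin 4 → (Fin 4 → ℤ) → (Fin 4 → ℤ) → Fib 3 → ℝ) :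
    symR2An1 Lc N cΛ γ X2s 0 = symR2An1 Lc N cΛ γ X2s' 0 := rfl

/-- [folklore] Congruence of the split defect in the level-`j` table (only `X2s j` is read). -/
theorem symΔOfAt_congr_table (N : ℕ) (cΛ : ℝ) (γ : ℕ → ℝ) (X2s X2s' : ℕ → Fin 4 → Fin 4 → (Fin 4 → ℤ) → Fin 4 → (Fin 4 → ℤ) → (Fin 4 → ℤ) → Fib 3 → ℝ) (j : ℕ)
    (hj : X2s j = X2s' j) (R : Fin 4 → Fin 4 → (Fin 4 → ℤ) → Fin 4 → (Fin 4 → ℤ) → MKer 4 (Fib 3)) :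
    symΔOfAt Lc N cΛ γ X2s j R = symΔOfAt Lc N cΛ γ X2s' j R := by
  funext α μ y ν y'
  rw [symΔOfAt_table_shift N cΛ γ X2s X2s' j R, hj, add_sub_cancel_right]

/-- [folklore] **THE REMAINDER AT LEVEL `j` READS THE TABLE ONLY BELOW `j`**: if `X2s k = X2s′ k` for all `k < j` then
`symR2An1 … X2s j = symR2An1 … X2s′ j` (induction on the (N11) recursion; the base reads no table). -/
theorem symR2An1_eq_of_agree_below (N : ℕ) (cΛ : ℝ) (γ : ℕ → ℝ) (X2s X2s' : ℕ → Fin 4 → Fin 4 → (Fin 4 → ℤ) → Fin 4 → (Fin 4 → ℤ) → (Fin 4 → ℤ) → Fib 3 → ℝ) :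
    ∀ j : ℕ, (∀ k, k < j → X2s k = X2s' k) → symR2An1 Lc N cΛ γ X2s j = symR2An1 Lc N cΛ γ X2s' j
  | 0, _ => rfl
  | j + 1, h => by
      have hj : X2s j = X2s' j := h j (Nat.lt_succ_self j)
      have ih : symR2An1 Lc N cΛ γ X2s j = symR2An1 Lc N cΛ γ X2s' j :=
        symR2An1_eq_of_agree_below N cΛ γ X2s X2s' j (fun k hk => h k (Nat.lt_succ_of_lt hk))
      have hΔ : symΔOfAt Lc N cΛ γ X2s j (symR2An1 Lc N cΛ γ X2s' j) = symΔOfAt Lc N cΛ γ X2s' j (symR2An1 Lc N cΛ γ X2s' j) :=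
        symΔOfAt_congr_table N cΛ γ X2s X2s' j hj _
      funext α κ u κ' u'
      simp only [symR2An1, ih, hj, hΔ]

/-! ## §2 The transfer: ROOT N's `hcomp` left side is the same number for every table with the same level-`j` remainder -/

/-- **THE CONTACT TABLE DOES NOT ENTER `hcomp` AT ITS OWN LEVEL.**  For two tables `X2s`, `X2s′` in the separation class of ROOT N (`hX`, `hX′`)
with `symR2An1 … X2s j = symR2An1 … X2s′ j`, ROOT N's `hcomp` LEFT SIDE (tree text VERBATIM) at `(j, α, μ, y, ν, y′)` takes the same value at
`X2s` and at `X2s′`.  [folklore] bookkeeping + trace cyclicity; NOT a proof ∕ evaluation of `hcomp`. -/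
theorem hcompLHS_eq_of_symR2An1_eq (hLc : Odd Lc) (N : ℕ) (cΛ : ℝ) (γ : ℕ → ℝ) (X2s X2s' : ℕ → Fin 4 → Fin 4 → (Fin 4 → ℤ) → Fin 4 → (Fin 4 → ℤ) → (Fin 4 → ℤ) → Fib 3 → ℝ)
    (hX : ∀ (j : ℕ) (α : Fin 4), ∃ C δ : ℝ, 0 < δ ∧ ∀ μ y ν y', BiLoc (diagK (X2s j α μ y ν y')) ((Lc : ℤ) • y) ((Lc : ℤ) • y)
      (C * Real.exp (-δ * l1 ((Lc : ℤ) • y - (Lc : ℤ) • y'))) δ)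
    (hX' : ∀ (j : ℕ) (α : Fin 4), ∃ C δ : ℝ, 0 < δ ∧ ∀ μ y ν y', BiLoc (diagK (X2s' j α μ y ν y')) ((Lc : ℤ) • y) ((Lc : ℤ) • y)
      (C * Real.exp (-δ * l1 ((Lc : ℤ) • y - (Lc : ℤ) • y'))) δ)
    (j : ℕ) (hR : symR2An1 Lc N cΛ γ X2s j = symR2An1 Lc N cΛ γ X2s' j)
    (α μ : Fin 4) (y : Fin 4 → ℤ) (ν : Fin 4) (y' : Fin 4 → ℤ) :
    (1 / 2 : ℝ) * tadpole (coDressKSymAt (toSite (ctrOff 4 Lc)) Lc (KInvStep (d := 3) Lc j))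
        ((1 / 2 : ℝ) • conjV (bhKStepSh 3 Lc (Dsh Lc) j) (diagK fun p a => X2s j α ν y' μ y p a - X2s j α μ y ν y' p a) +
          (1 / 2 : ℝ) • (symΔAn1 Lc N cΛ γ X2s j α μ y ν y' + symΔAn1 Lc N cΛ γ X2s j α ν y' μ y))
        + conjDefect (coDressKSymAt (toSite (ctrOff 4 Lc)) Lc (KInvStep (d := 3) Lc j)) (bhKStepSh 3 Lc (Dsh Lc) j)
            (vertexOfK (coDressKSymAt (toSite (ctrOff 4 Lc)) Lc (KInvStep (d := 3) Lc j)) Lc (JsB12Sym0 hLc N (symTablesAn1S2 3 Lc cΛ) cΛ (-((Lc : ℝ) ^ 12 / 4)) j).S μ y)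
            (vertexOfK (coDressKSymAt (toSite (ctrOff 4 Lc)) Lc (KInvStep (d := 3) Lc j)) Lc (JsB12Sym0 hLc N (symTablesAn1S2 3 Lc cΛ) cΛ (-((Lc : ℝ) ^ 12 / 4)) j).S ν y')
            (vertexOfK (coDressKSymAt (toSite (ctrOff 4 Lc)) Lc (KInvStep (d := 3) Lc j)) Lc (fun κ u => γ j • diagK (ctGenM 3 (bhK Lc + Dsh Lc) α Lc κ u)) μ y)
            (vertexOfK (coDressKSymAt (toSite (ctrOff 4 Lc)) Lc (KInvStep (d := 3) Lc j)) Lc (fun κ u => γ j • diagK (ctGenM 3 (bhK Lc + Dsh Lc) α Lc κ u)) ν y')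
            (diagK (X2s j α μ y ν y'))
      =
    (1 / 2 : ℝ) * tadpole (coDressKSymAt (toSite (ctrOff 4 Lc)) Lc (KInvStep (d := 3) Lc j))
        ((1 / 2 : ℝ) • conjV (bhKStepSh 3 Lc (Dsh Lc) j) (diagK fun p a => X2s' j α ν y' μ y p a - X2s' j α μ y ν y' p a) +
          (1 / 2 : ℝ) • (symΔAn1 Lc N cΛ γ X2s' j α μ y ν y' + symΔAn1 Lc N cΛ γ X2s' j α ν y' μ y))
        + conjDefect (coDressKSymAt (toSite (ctrOff 4 Lc)) Lc (KInvStep (d := 3) Lc j)) (bhKStepSh 3 Lc (Dsh Lc) j)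
            (vertexOfK (coDressKSymAt (toSite (ctrOff 4 Lc)) Lc (KInvStep (d := 3) Lc j)) Lc (JsB12Sym0 hLc N (symTablesAn1S2 3 Lc cΛ) cΛ (-((Lc : ℝ) ^ 12 / 4)) j).S μ y)
            (vertexOfK (coDressKSymAt (toSite (ctrOff 4 Lc)) Lc (KInvStep (d := 3) Lc j)) Lc (JsB12Sym0 hLc N (symTablesAn1S2 3 Lc cΛ) cΛ (-((Lc : ℝ) ^ 12 / 4)) j).S ν y')
            (vertexOfK (coDressKSymAt (toSite (ctrOff 4 Lc)) Lc (KInvStep (d := 3) Lc j)) Lc (fun κ u => γ j • diagK (ctGenM 3 (bhK Lc + Dsh Lc) α Lc κ u)) μ y)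
            (vertexOfK (coDressKSymAt (toSite (ctrOff 4 Lc)) Lc (KInvStep (d := 3) Lc j)) Lc (fun κ u => γ j • diagK (ctGenM 3 (bhK Lc + Dsh Lc) α Lc κ u)) ν y')
            (diagK (X2s' j α μ y ν y')) := by
  have hL1 : 1 ≤ Lc := one_le_of_neZero Lc
  have hA : Spr (coDressKSymAt (toSite (ctrOff 4 Lc)) Lc (KInvStep (d := 3) Lc j)) := spr_Gsym (d := 3) (Lc := Lc) j
  have hM : Spr (bhKStepSh 3 Lc (Dsh Lc) j) := spr_bhKStepSh (spr_Dsh (d := 3) hL1) j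
  -- localisation of the letters involved
  have locX : ∀ (X : ℕ → Fin 4 → Fin 4 → (Fin 4 → ℤ) → Fin 4 → (Fin 4 → ℤ) → (Fin 4 → ℤ) → Fib 3 → ℝ), (∀ (j : ℕ) (α : Fin 4), ∃ C δ : ℝ, 0 < δ ∧ ∀ μ y ν y', BiLoc (diagK (X j α μ y ν y')) ((Lc : ℤ) • y) ((Lc : ℤ) • y)
      (C * Real.exp (-δ * l1 ((Lc : ℤ) • y - (Lc : ℤ) • y'))) δ) →
      ∀ μ y ν y', Loc (diagK (X j α μ y ν y')) := fun X h μ y ν y' => by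
    obtain ⟨C, δ, hδ, hh⟩ := h j α
    exact ⟨_, _, _, δ, hδ, hh μ y ν y'⟩
  have hgX : Loc (diagK (X2s j α μ y ν y')) := locX X2s hX μ y ν y'
  have hgX' : Loc (diagK (X2s' j α μ y ν y')) := locX X2s' hX' μ y ν y'
  have hhX' : Loc (diagK (X2s' j α ν y' μ y)) := locX X2s' hX' ν y' μ y
  have hΔ' : ∀ μ y ν y', Loc (symΔAn1 Lc N cΛ γ X2s' j α μ y ν y') := fun μ y ν y' => loc_symΔAn1 (Lc := Lc) N cΛ γ X2s' hX' j α μ y ν y'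
  -- the two split defects of `X2s` through those of `X2s'`
  have e1 := symΔAn1_table_shift (Lc := Lc) N cΛ γ X2s X2s' j hR α μ y ν y'
  have e2 := symΔAn1_table_shift (Lc := Lc) N cΛ γ X2s X2s' j hR α ν y' μ y
  -- the W-slot of `X2s` = the W-slot of `X2s'` minus the contact of the table difference
  have eW : (1 / 2 : ℝ) • conjV (bhKStepSh 3 Lc (Dsh Lc) j) (diagK fun p a => X2s j α ν y' μ y p a - X2s j α μ y ν y' p a) +
        (1 / 2 : ℝ) • (symΔAn1 Lc N cΛ γ X2s j α μ y ν y' + symΔAn1 Lc N cΛ γ X2s j α ν y' μ y)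
      = ((1 / 2 : ℝ) • conjV (bhKStepSh 3 Lc (Dsh Lc) j) (diagK fun p a => X2s' j α ν y' μ y p a - X2s' j α μ y ν y' p a) +
          (1 / 2 : ℝ) • (symΔAn1 Lc N cΛ γ X2s' j α μ y ν y' + symΔAn1 Lc N cΛ γ X2s' j α ν y' μ y))
        - conjV (bhKStepSh 3 Lc (Dsh Lc) j) (diagK fun p a => X2s j α μ y ν y' p a - X2s' j α μ y ν y' p a) := by
    rw [e1, e2]
    funext x z a b
    simp only [Pi.add_apply, Pi.sub_apply, Pi.smul_apply, smul_eq_mul, conjV_diagK_apply]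
    ring
  have eX : diagK (X2s j α μ y ν y') = diagK (X2s' j α μ y ν y') + diagK (fun p a => X2s j α μ y ν y' p a - X2s' j α μ y ν y' p a) := by
    rw [← diagK_add_symbol]
    congr 1
    funext p a
    ring
  have hY : Loc (diagK fun p a => X2s j α μ y ν y' p a - X2s' j α μ y ν y' p a) := by
    have h := hgX.sub hgX'
    have e : diagK (X2s j α μ y ν y') - diagK (X2s' j α μ y ν y') = diagK (fun p a => X2s j α μ y ν y' p a - X2s' j α μ y ν y' p a) := by
      funext x z a' b'
      simp only [Pi.sub_apply, BorderedHessian.diagK_apply]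
      split_ifs <;> simp
    rwa [e] at h
  have hW' : Loc ((1 / 2 : ℝ) • conjV (bhKStepSh 3 Lc (Dsh Lc) j) (diagK fun p a => X2s' j α ν y' μ y p a - X2s' j α μ y ν y' p a) +
        (1 / 2 : ℝ) • (symΔAn1 Lc N cΛ γ X2s' j α μ y ν y' + symΔAn1 Lc N cΛ γ X2s' j α ν y' μ y)) := by
    have hd : Loc (diagK fun p a => X2s' j α ν y' μ y p a - X2s' j α μ y ν y' p a) := by
      have h := hhX'.sub hgX'
      have e : diagK (X2s' j α ν y' μ y) - diagK (X2s' j α μ y ν y') = diagK (fun p a => X2s' j α ν y' μ y p a - X2s' j α μ y ν y' p a) := by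
        funext x z a' b'
        simp only [Pi.sub_apply, BorderedHessian.diagK_apply]
        split_ifs <;> simp
      rwa [e] at h
    exact ((loc_conjV hM hd).smul _).add (((hΔ' μ y ν y').add (hΔ' ν y' μ y)).smul _)
  rw [eW, eX]
  exact n8Functional_shift hA hM hW' hY hgX' _ _ _ _

/-- **LEVEL 0 — UNCONDITIONALLY**: ROOT N's `hcomp` left side at `j = 0` is the same number for ANY two tables in the class (the level-0
remainder reads no table).  With `X2s′ := 0` (`SymSecondOrderDeltaSep.sep_zeroTable`): a level-0 verdict at the pin (ROOT M′) is a level-0 verdict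
for ROOT N at every table. [folklore] -/
theorem hcompLHS_zero_eq (hLc : Odd Lc) (N : ℕ) (cΛ : ℝ) (γ : ℕ → ℝ) (X2s X2s' : ℕ → Fin 4 → Fin 4 → (Fin 4 → ℤ) → Fin 4 → (Fin 4 → ℤ) → (Fin 4 → ℤ) → Fib 3 → ℝ)
    (hX : ∀ (j : ℕ) (α : Fin 4), ∃ C δ : ℝ, 0 < δ ∧ ∀ μ y ν y', BiLoc (diagK (X2s j α μ y ν y')) ((Lc : ℤ) • y) ((Lc : ℤ) • y)
      (C * Real.exp (-δ * l1 ((Lc : ℤ) • y - (Lc : ℤ) • y'))) δ)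
    (hX' : ∀ (j : ℕ) (α : Fin 4), ∃ C δ : ℝ, 0 < δ ∧ ∀ μ y ν y', BiLoc (diagK (X2s' j α μ y ν y')) ((Lc : ℤ) • y) ((Lc : ℤ) • y)
      (C * Real.exp (-δ * l1 ((Lc : ℤ) • y - (Lc : ℤ) • y'))) δ)
    (α μ : Fin 4) (y : Fin 4 → ℤ) (ν : Fin 4) (y' : Fin 4 → ℤ) :
    (1 / 2 : ℝ) * tadpole (coDressKSymAt (toSite (ctrOff 4 Lc)) Lc (KInvStep (d := 3) Lc 0))
        ((1 / 2 : ℝ) • conjV (bhKStepSh 3 Lc (Dsh Lc) 0) (diagK fun p a => X2s 0 α ν y' μ y p a - X2s 0 α μ y ν y' p a) +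
          (1 / 2 : ℝ) • (symΔAn1 Lc N cΛ γ X2s 0 α μ y ν y' + symΔAn1 Lc N cΛ γ X2s 0 α ν y' μ y))
        + conjDefect (coDressKSymAt (toSite (ctrOff 4 Lc)) Lc (KInvStep (d := 3) Lc 0)) (bhKStepSh 3 Lc (Dsh Lc) 0)
            (vertexOfK (coDressKSymAt (toSite (ctrOff 4 Lc)) Lc (KInvStep (d := 3) Lc 0)) Lc (JsB12Sym0 hLc N (symTablesAn1S2 3 Lc cΛ) cΛ (-((Lc : ℝ) ^ 12 / 4)) 0).S μ y)
            (vertexOfK (coDressKSymAt (toSite (ctrOff 4 Lc)) Lc (KInvStep (d := 3) Lc 0)) Lc (JsB12Sym0 hLc N (symTablesAn1S2 3 Lc cΛ) cΛ (-((Lc : ℝ) ^ 12 / 4)) 0).S ν y')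
            (vertexOfK (coDressKSymAt (toSite (ctrOff 4 Lc)) Lc (KInvStep (d := 3) Lc 0)) Lc (fun κ u => γ 0 • diagK (ctGenM 3 (bhK Lc + Dsh Lc) α Lc κ u)) μ y)
            (vertexOfK (coDressKSymAt (toSite (ctrOff 4 Lc)) Lc (KInvStep (d := 3) Lc 0)) Lc (fun κ u => γ 0 • diagK (ctGenM 3 (bhK Lc + Dsh Lc) α Lc κ u)) ν y')
            (diagK (X2s 0 α μ y ν y'))
      =
    (1 / 2 : ℝ) * tadpole (coDressKSymAt (toSite (ctrOff 4 Lc)) Lc (KInvStep (d := 3) Lc 0))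
        ((1 / 2 : ℝ) • conjV (bhKStepSh 3 Lc (Dsh Lc) 0) (diagK fun p a => X2s' 0 α ν y' μ y p a - X2s' 0 α μ y ν y' p a) +
          (1 / 2 : ℝ) • (symΔAn1 Lc N cΛ γ X2s' 0 α μ y ν y' + symΔAn1 Lc N cΛ γ X2s' 0 α ν y' μ y))
        + conjDefect (coDressKSymAt (toSite (ctrOff 4 Lc)) Lc (KInvStep (d := 3) Lc 0)) (bhKStepSh 3 Lc (Dsh Lc) 0)
            (vertexOfK (coDressKSymAt (toSite (ctrOff 4 Lc)) Lc (KInvStep (d := 3) Lc 0)) Lc (JsB12Sym0 hLc N (symTablesAn1S2 3 Lc cΛ) cΛ (-((Lc : ℝ) ^ 12 / 4)) 0).S μ y)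
            (vertexOfK (coDressKSymAt (toSite (ctrOff 4 Lc)) Lc (KInvStep (d := 3) Lc 0)) Lc (JsB12Sym0 hLc N (symTablesAn1S2 3 Lc cΛ) cΛ (-((Lc : ℝ) ^ 12 / 4)) 0).S ν y')
            (vertexOfK (coDressKSymAt (toSite (ctrOff 4 Lc)) Lc (KInvStep (d := 3) Lc 0)) Lc (fun κ u => γ 0 • diagK (ctGenM 3 (bhK Lc + Dsh Lc) α Lc κ u)) μ y)
            (vertexOfK (coDressKSymAt (toSite (ctrOff 4 Lc)) Lc (KInvStep (d := 3) Lc 0)) Lc (fun κ u => γ 0 • diagK (ctGenM 3 (bhK Lc + Dsh Lc) α Lc κ u)) ν y')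
            (diagK (X2s' 0 α μ y ν y')) :=
  hcompLHS_eq_of_symR2An1_eq hLc N cΛ γ X2s X2s' hX hX' 0 rfl α μ y ν y'

/-- **AT THE PIN**: ROOT N's level-0 `hcomp` left side at ANY table `X2s` of the class equals the one at the pin `X2s := 0` — ROOT M′'s level-0
`hcomp` left side at `γ` (ROOT M′ displays it at its pinned `γ₀`; instantiate `γ := γ₀`).  So a level-0 verdict on `hcomp` AT THE PIN — where the
engine line R-D1-N8-QODD is aimed (its identification with this left side is an3's memo-level reading, not a tree fact) — is a level-0 verdict for
ROOT N at every table, not for ROOT M′ alone (I-d1ref65-1). [folklore] -/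
theorem hcompLHS_zero_eq_pin (hLc : Odd Lc) (N : ℕ) (cΛ : ℝ) (γ : ℕ → ℝ) (X2s : ℕ → Fin 4 → Fin 4 → (Fin 4 → ℤ) → Fin 4 → (Fin 4 → ℤ) → (Fin 4 → ℤ) → Fib 3 → ℝ)
    (hX : ∀ (j : ℕ) (α : Fin 4), ∃ C δ : ℝ, 0 < δ ∧ ∀ μ y ν y', BiLoc (diagK (X2s j α μ y ν y')) ((Lc : ℤ) • y) ((Lc : ℤ) • y)
      (C * Real.exp (-δ * l1 ((Lc : ℤ) • y - (Lc : ℤ) • y'))) δ)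
    (α μ : Fin 4) (y : Fin 4 → ℤ) (ν : Fin 4) (y' : Fin 4 → ℤ) :
    (1 / 2 : ℝ) * tadpole (coDressKSymAt (toSite (ctrOff 4 Lc)) Lc (KInvStep (d := 3) Lc 0))
        ((1 / 2 : ℝ) • conjV (bhKStepSh 3 Lc (Dsh Lc) 0) (diagK fun p a => X2s 0 α ν y' μ y p a - X2s 0 α μ y ν y' p a) +
          (1 / 2 : ℝ) • (symΔAn1 Lc N cΛ γ X2s 0 α μ y ν y' + symΔAn1 Lc N cΛ γ X2s 0 α ν y' μ y))
        + conjDefect (coDressKSymAt (toSite (ctrOff 4 Lc)) Lc (KInvStep (d := 3) Lc 0)) (bhKStepSh 3 Lc (Dsh Lc) 0)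
            (vertexOfK (coDressKSymAt (toSite (ctrOff 4 Lc)) Lc (KInvStep (d := 3) Lc 0)) Lc (JsB12Sym0 hLc N (symTablesAn1S2 3 Lc cΛ) cΛ (-((Lc : ℝ) ^ 12 / 4)) 0).S μ y)
            (vertexOfK (coDressKSymAt (toSite (ctrOff 4 Lc)) Lc (KInvStep (d := 3) Lc 0)) Lc (JsB12Sym0 hLc N (symTablesAn1S2 3 Lc cΛ) cΛ (-((Lc : ℝ) ^ 12 / 4)) 0).S ν y')
            (vertexOfK (coDressKSymAt (toSite (ctrOff 4 Lc)) Lc (KInvStep (d := 3) Lc 0)) Lc (fun κ u => γ 0 • diagK (ctGenM 3 (bhK Lc + Dsh Lc) α Lc κ u)) μ y)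
            (vertexOfK (coDressKSymAt (toSite (ctrOff 4 Lc)) Lc (KInvStep (d := 3) Lc 0)) Lc (fun κ u => γ 0 • diagK (ctGenM 3 (bhK Lc + Dsh Lc) α Lc κ u)) ν y')
            (diagK (X2s 0 α μ y ν y'))
      =
    (1 / 2 : ℝ) * tadpole (coDressKSymAt (toSite (ctrOff 4 Lc)) Lc (KInvStep (d := 3) Lc 0))
        ((1 / 2 : ℝ) • conjV (bhKStepSh 3 Lc (Dsh Lc) 0) (diagK fun p a => (0 : ℕ → Fin 4 → Fin 4 → (Fin 4 → ℤ) → Fin 4 → (Fin 4 → ℤ) → (Fin 4 → ℤ) → Fib 3 → ℝ) 0 α ν y' μ y p a - (0 : ℕ → Fin 4 → Fin 4 → (Fin 4 → ℤ) → Fin 4 → (Fin 4 → ℤ) → (Fin 4 → ℤ) → Fib 3 → ℝ) 0 α μ y ν y' p a) +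
          (1 / 2 : ℝ) • (symΔAn1 Lc N cΛ γ (0 : ℕ → Fin 4 → Fin 4 → (Fin 4 → ℤ) → Fin 4 → (Fin 4 → ℤ) → (Fin 4 → ℤ) → Fib 3 → ℝ) 0 α μ y ν y' + symΔAn1 Lc N cΛ γ (0 : ℕ → Fin 4 → Fin 4 → (Fin 4 → ℤ) → Fin 4 → (Fin 4 → ℤ) → (Fin 4 → ℤ) → Fib 3 → ℝ) 0 α ν y' μ y))
        + conjDefect (coDressKSymAt (toSite (ctrOff 4 Lc)) Lc (KInvStep (d := 3) Lc 0)) (bhKStepSh 3 Lc (Dsh Lc) 0)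
            (vertexOfK (coDressKSymAt (toSite (ctrOff 4 Lc)) Lc (KInvStep (d := 3) Lc 0)) Lc (JsB12Sym0 hLc N (symTablesAn1S2 3 Lc cΛ) cΛ (-((Lc : ℝ) ^ 12 / 4)) 0).S μ y)
            (vertexOfK (coDressKSymAt (toSite (ctrOff 4 Lc)) Lc (KInvStep (d := 3) Lc 0)) Lc (JsB12Sym0 hLc N (symTablesAn1S2 3 Lc cΛ) cΛ (-((Lc : ℝ) ^ 12 / 4)) 0).S ν y')
            (vertexOfK (coDressKSymAt (toSite (ctrOff 4 Lc)) Lc (KInvStep (d := 3) Lc 0)) Lc (fun κ u => γ 0 • diagK (ctGenM 3 (bhK Lc + Dsh Lc) α Lc κ u)) μ y)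
            (vertexOfK (coDressKSymAt (toSite (ctrOff 4 Lc)) Lc (KInvStep (d := 3) Lc 0)) Lc (fun κ u => γ 0 • diagK (ctGenM 3 (bhK Lc + Dsh Lc) α Lc κ u)) ν y')
            (diagK ((0 : ℕ → Fin 4 → Fin 4 → (Fin 4 → ℤ) → Fin 4 → (Fin 4 → ℤ) → (Fin 4 → ℤ) → Fib 3 → ℝ) 0 α μ y ν y')) :=
  hcompLHS_eq_of_symR2An1_eq hLc N cΛ γ X2s 0 hX (sep_zeroTable (Lc := Lc)) 0 rfl α μ y ν y'

/-- **`hcomp` AT LEVEL `j` DOES NOT READ THE TABLE AT LEVELS `≥ j`**: if two tables of the class agree BELOW `j`, ROOT N's `hcomp` left side at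
`(j, α, μ, y, ν, y′)` is the same number for both — the OWNER's «`X2s` immaterial» in its honest kernel scope (the table at levels `< j` does
enter, through `symR2An1 … j`). [folklore] -/
theorem hcompLHS_eq_of_agree_below (hLc : Odd Lc) (N : ℕ) (cΛ : ℝ) (γ : ℕ → ℝ) (X2s X2s' : ℕ → Fin 4 → Fin 4 → (Fin 4 → ℤ) → Fin 4 → (Fin 4 → ℤ) → (Fin 4 → ℤ) → Fib 3 → ℝ)
    (hX : ∀ (j : ℕ) (α : Fin 4), ∃ C δ : ℝ, 0 < δ ∧ ∀ μ y ν y', BiLoc (diagK (X2s j α μ y ν y')) ((Lc : ℤ) • y) ((Lc : ℤ) • y)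
      (C * Real.exp (-δ * l1 ((Lc : ℤ) • y - (Lc : ℤ) • y'))) δ)
    (hX' : ∀ (j : ℕ) (α : Fin 4), ∃ C δ : ℝ, 0 < δ ∧ ∀ μ y ν y', BiLoc (diagK (X2s' j α μ y ν y')) ((Lc : ℤ) • y) ((Lc : ℤ) • y)
      (C * Real.exp (-δ * l1 ((Lc : ℤ) • y - (Lc : ℤ) • y'))) δ)
    (j : ℕ) (h : ∀ k, k < j → X2s k = X2s' k)
    (α μ : Fin 4) (y : Fin 4 → ℤ) (ν : Fin 4) (y' : Fin 4 → ℤ) :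
    (1 / 2 : ℝ) * tadpole (coDressKSymAt (toSite (ctrOff 4 Lc)) Lc (KInvStep (d := 3) Lc j))
        ((1 / 2 : ℝ) • conjV (bhKStepSh 3 Lc (Dsh Lc) j) (diagK fun p a => X2s j α ν y' μ y p a - X2s j α μ y ν y' p a) +
          (1 / 2 : ℝ) • (symΔAn1 Lc N cΛ γ X2s j α μ y ν y' + symΔAn1 Lc N cΛ γ X2s j α ν y' μ y))
        + conjDefect (coDressKSymAt (toSite (ctrOff 4 Lc)) Lc (KInvStep (d := 3) Lc j)) (bhKStepSh 3 Lc (Dsh Lc) j)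
            (vertexOfK (coDressKSymAt (toSite (ctrOff 4 Lc)) Lc (KInvStep (d := 3) Lc j)) Lc (JsB12Sym0 hLc N (symTablesAn1S2 3 Lc cΛ) cΛ (-((Lc : ℝ) ^ 12 / 4)) j).S μ y)
            (vertexOfK (coDressKSymAt (toSite (ctrOff 4 Lc)) Lc (KInvStep (d := 3) Lc j)) Lc (JsB12Sym0 hLc N (symTablesAn1S2 3 Lc cΛ) cΛ (-((Lc : ℝ) ^ 12 / 4)) j).S ν y')
            (vertexOfK (coDressKSymAt (toSite (ctrOff 4 Lc)) Lc (KInvStep (d := 3) Lc j)) Lc (fun κ u => γ j • diagK (ctGenM 3 (bhK Lc + Dsh Lc) α Lc κ u)) μ y)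
            (vertexOfK (coDressKSymAt (toSite (ctrOff 4 Lc)) Lc (KInvStep (d := 3) Lc j)) Lc (fun κ u => γ j • diagK (ctGenM 3 (bhK Lc + Dsh Lc) α Lc κ u)) ν y')
            (diagK (X2s j α μ y ν y'))
      =
    (1 / 2 : ℝ) * tadpole (coDressKSymAt (toSite (ctrOff 4 Lc)) Lc (KInvStep (d := 3) Lc j))
        ((1 / 2 : ℝ) • conjV (bhKStepSh 3 Lc (Dsh Lc) j) (diagK fun p a => X2s' j α ν y' μ y p a - X2s' j α μ y ν y' p a) +
          (1 / 2 : ℝ) • (symΔAn1 Lc N cΛ γ X2s' j α μ y ν y' + symΔAn1 Lc N cΛ γ X2s' j α ν y' μ y))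
        + conjDefect (coDressKSymAt (toSite (ctrOff 4 Lc)) Lc (KInvStep (d := 3) Lc j)) (bhKStepSh 3 Lc (Dsh Lc) j)
            (vertexOfK (coDressKSymAt (toSite (ctrOff 4 Lc)) Lc (KInvStep (d := 3) Lc j)) Lc (JsB12Sym0 hLc N (symTablesAn1S2 3 Lc cΛ) cΛ (-((Lc : ℝ) ^ 12 / 4)) j).S μ y)
            (vertexOfK (coDressKSymAt (toSite (ctrOff 4 Lc)) Lc (KInvStep (d := 3) Lc j)) Lc (JsB12Sym0 hLc N (symTablesAn1S2 3 Lc cΛ) cΛ (-((Lc : ℝ) ^ 12 / 4)) j).S ν y')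
            (vertexOfK (coDressKSymAt (toSite (ctrOff 4 Lc)) Lc (KInvStep (d := 3) Lc j)) Lc (fun κ u => γ j • diagK (ctGenM 3 (bhK Lc + Dsh Lc) α Lc κ u)) μ y)
            (vertexOfK (coDressKSymAt (toSite (ctrOff 4 Lc)) Lc (KInvStep (d := 3) Lc j)) Lc (fun κ u => γ j • diagK (ctGenM 3 (bhK Lc + Dsh Lc) α Lc κ u)) ν y')
            (diagK (X2s' j α μ y ν y')) :=
  hcompLHS_eq_of_symR2An1_eq hLc N cΛ γ X2s X2s' hX hX' j (symR2An1_eq_of_agree_below N cΛ γ X2s X2s' j h) α μ y ν y'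

/-- **ROOT-LEVEL READING — LEVEL 0 OF `hcomp` TRANSFERS FROM THE PIN TO EVERY TABLE**: if ROOT M′'s `hcomp` holds at level 0 (stated here
for a general `γ`; ROOT M′ displays `γ₀`, a `β`-instance), then ROOT N's `hcomp` holds at level 0 for every table of the class.  Contrapositive:
a level-0 FAILURE at the pin is a level-0 failure for ROOT N at every table.  [folklore] NOT a proof ∕ evaluation of `hcomp`. -/
theorem hcomp_zero_transfer_of_pin (hLc : Odd Lc) (N : ℕ) (cΛ : ℝ) (γ : ℕ → ℝ)
    (h0 : ∀ (α μ : Fin 4) (y : Fin 4 → ℤ) (ν : Fin 4) (y' : Fin 4 → ℤ),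
      (1 / 2 : ℝ) * tadpole (coDressKSymAt (toSite (ctrOff 4 Lc)) Lc (KInvStep (d := 3) Lc 0))
        ((1 / 2 : ℝ) • conjV (bhKStepSh 3 Lc (Dsh Lc) 0) (diagK fun p a => (0 : ℕ → Fin 4 → Fin 4 → (Fin 4 → ℤ) → Fin 4 → (Fin 4 → ℤ) → (Fin 4 → ℤ) → Fib 3 → ℝ) 0 α ν y' μ y p a - (0 : ℕ → Fin 4 → Fin 4 → (Fin 4 → ℤ) → Fin 4 → (Fin 4 → ℤ) → (Fin 4 → ℤ) → Fib 3 → ℝ) 0 α μ y ν y' p a) +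
          (1 / 2 : ℝ) • (symΔAn1 Lc N cΛ γ (0 : ℕ → Fin 4 → Fin 4 → (Fin 4 → ℤ) → Fin 4 → (Fin 4 → ℤ) → (Fin 4 → ℤ) → Fib 3 → ℝ) 0 α μ y ν y' + symΔAn1 Lc N cΛ γ (0 : ℕ → Fin 4 → Fin 4 → (Fin 4 → ℤ) → Fin 4 → (Fin 4 → ℤ) → (Fin 4 → ℤ) → Fib 3 → ℝ) 0 α ν y' μ y))
        + conjDefect (coDressKSymAt (toSite (ctrOff 4 Lc)) Lc (KInvStep (d := 3) Lc 0)) (bhKStepSh 3 Lc (Dsh Lc) 0)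
            (vertexOfK (coDressKSymAt (toSite (ctrOff 4 Lc)) Lc (KInvStep (d := 3) Lc 0)) Lc (JsB12Sym0 hLc N (symTablesAn1S2 3 Lc cΛ) cΛ (-((Lc : ℝ) ^ 12 / 4)) 0).S μ y)
            (vertexOfK (coDressKSymAt (toSite (ctrOff 4 Lc)) Lc (KInvStep (d := 3) Lc 0)) Lc (JsB12Sym0 hLc N (symTablesAn1S2 3 Lc cΛ) cΛ (-((Lc : ℝ) ^ 12 / 4)) 0).S ν y')
            (vertexOfK (coDressKSymAt (toSite (ctrOff 4 Lc)) Lc (KInvStep (d := 3) Lc 0)) Lc (fun κ u => γ 0 • diagK (ctGenM 3 (bhK Lc + Dsh Lc) α Lc κ u)) μ y)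
            (vertexOfK (coDressKSymAt (toSite (ctrOff 4 Lc)) Lc (KInvStep (d := 3) Lc 0)) Lc (fun κ u => γ 0 • diagK (ctGenM 3 (bhK Lc + Dsh Lc) α Lc κ u)) ν y')
            (diagK ((0 : ℕ → Fin 4 → Fin 4 → (Fin 4 → ℤ) → Fin 4 → (Fin 4 → ℤ) → (Fin 4 → ℤ) → Fib 3 → ℝ) 0 α μ y ν y')) = 0)
    (X2s : ℕ → Fin 4 → Fin 4 → (Fin 4 → ℤ) → Fin 4 → (Fin 4 → ℤ) → (Fin 4 → ℤ) → Fib 3 → ℝ)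
    (hX : ∀ (j : ℕ) (α : Fin 4), ∃ C δ : ℝ, 0 < δ ∧ ∀ μ y ν y', BiLoc (diagK (X2s j α μ y ν y')) ((Lc : ℤ) • y) ((Lc : ℤ) • y)
      (C * Real.exp (-δ * l1 ((Lc : ℤ) • y - (Lc : ℤ) • y'))) δ)
    (α μ : Fin 4) (y : Fin 4 → ℤ) (ν : Fin 4) (y' : Fin 4 → ℤ) :
    (1 / 2 : ℝ) * tadpole (coDressKSymAt (toSite (ctrOff 4 Lc)) Lc (KInvStep (d := 3) Lc 0))
        ((1 / 2 : ℝ) • conjV (bhKStepSh 3 Lc (Dsh Lc) 0) (diagK fun p a => X2s 0 α ν y' μ y p a - X2s 0 α μ y ν y' p a) +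
          (1 / 2 : ℝ) • (symΔAn1 Lc N cΛ γ X2s 0 α μ y ν y' + symΔAn1 Lc N cΛ γ X2s 0 α ν y' μ y))
        + conjDefect (coDressKSymAt (toSite (ctrOff 4 Lc)) Lc (KInvStep (d := 3) Lc 0)) (bhKStepSh 3 Lc (Dsh Lc) 0)
            (vertexOfK (coDressKSymAt (toSite (ctrOff 4 Lc)) Lc (KInvStep (d := 3) Lc 0)) Lc (JsB12Sym0 hLc N (symTablesAn1S2 3 Lc cΛ) cΛ (-((Lc : ℝ) ^ 12 / 4)) 0).S μ y)
            (vertexOfK (coDressKSymAt (toSite (ctrOff 4 Lc)) Lc (KInvStep (d := 3) Lc 0)) Lc (JsB12Sym0 hLc N (symTablesAn1S2 3 Lc cΛ) cΛ (-((Lc : ℝ) ^ 12 / 4)) 0).S ν y')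
            (vertexOfK (coDressKSymAt (toSite (ctrOff 4 Lc)) Lc (KInvStep (d := 3) Lc 0)) Lc (fun κ u => γ 0 • diagK (ctGenM 3 (bhK Lc + Dsh Lc) α Lc κ u)) μ y)
            (vertexOfK (coDressKSymAt (toSite (ctrOff 4 Lc)) Lc (KInvStep (d := 3) Lc 0)) Lc (fun κ u => γ 0 • diagK (ctGenM 3 (bhK Lc + Dsh Lc) α Lc κ u)) ν y')
            (diagK (X2s 0 α μ y ν y')) = 0 :=
  (hcompLHS_zero_eq_pin hLc N cΛ γ X2s hX α μ y ν y').trans (h0 α μ y ν y')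

end Summit.QuantumFields.BalabanUV.Beta.SymContactTableTransfer

end
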